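/-
b2b-lace packet, LEAN TYPING SEAT 2 gen 15 (unit `b2b-lace-lean2-g15`).  (S2b)-IMPR, the H₂ leaf (L4) AT THE INTEGRAL LEVEL:
[NoBLE17] §3.3.5 Step 2 integrated against the `(l,x)`-kernel — the `T*`-slots majorised through `Ĉ* ≤ Ĉ/α̲_F`, the bound
DERIVED from (3.53) (slot `β_{R,Φ}`, factor `(Γ₂′)ⁿ` on every term), and its comparison with `F3Bounds.boundH2` (= (3.74) =
`General.nb` `BoundH[2]`) under an explicit hypothesis.  d-generic; no numeral, no dimension, no named fact; every existing
module untouched.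
-/
import Literature.Probability.FitznerVanDerHofstad2017.NobleH4StepD75
import HarnessLib

/-!
# Literature.Probability.FitznerVanDerHofstad2017.NobleH2Step — Step 2 of [NoBLE17] §3.3.5 integrated against the `(l,x)`-kernel

[NoBLE17] = Fitzner–van der Hofstad, *Generalized approach to the non-backtracking lace expansion*, PTRF 169 (2017) 1041–1119.

The Step-2 piece of the weighted diagram is `ℋ^{n,l}_{2,z}(x) = ∫ Ĥ₂(k) D̂(k)^l Ĝ_z(k)ⁿ D̂^{(x)}(k) dk/(2π)^d` ((3.58); kernel atom
`LapAtoms.H2` of `NobleLaplacianSplit`, which is (3.53):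
`Ĥ₂ = −(α_F (c_Φ + α_Φ D̂)(Ĉ* + 1/[1−F̂]) + α_Φ) Ê M̂* + α_F R̂_Φ(k)/[1−F̂]² · M̂*`).  `NobleLaplacianBounds` proves the pointwise bound
`KeyBounds.abs_H2_le` — `|Ĥ₂| ≤ β_{|ΔR,F|} K̲ [(c̄_Φ + β_{α,Φ}|D̂|)(1/α̲_F + K̲) Ĉ² + (β_{α,Φ}/α̲_F) Ĉ] |M̂*| + ᾱ_F β_{R,Φ} K̲² Ĉ² |M̂*|`
(`Ĉ = 1/[1 − D̂]`; the slot of `|R̂_Φ(k)|` is `β_{R,Φ}` = `KeyBounds.RΦ_abs`) — and `KeyBounds.abs_Mstar_le'` —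
`|M̂*| ≤ |D̂| + 2 D̂^{sin} Ĉ/α̲_F` (from `Ĉ* ≤ Ĉ/α_F ≤ Ĉ/α̲_F`, (3.40)–(3.43); this is how "`T*_{n,l}` is bounded in the same way as
`T_{n,l}`", the sentence after (3.72)).

THIS MODULE integrates.  With the `n` two-point lines (`|Ĝ| ≤ Γ₂′ Ĉ`, (3.47)) and the `T*`-SLOT MAJORANT

  `TS_{m,l}(x) := K_{m,l+1}(x) + (2/α̲_F) U_{m+1,l}(x)`   (`srwTS d α̲_F m l x`; `K`, `U` = `srwK`, `srwU` of (3.36), (3.38)),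

which dominates `∫ |D̂|^l Ĉ^m |D̂^{(x)}| |M̂*| dk/(2π)^d = T*_{m,l}(x)` of (3.72) pointwise, it proves, for any family of atoms `A k`
obeying `KeyBounds r` at every `k` of the cube with `D̂(k) < 1` and carrying `D = D̂(k)`, `Dsin = D̂^{sin}(k)`, and `d ≥ 2n + 7`:

  `|∫ Ĥ₂ Ĝⁿ D̂^l D̂^{(x)} dk/(2π)^d| ≤ β_{|ΔR,F|} K̲ (Γ₂′)ⁿ [(c̄_Φ TS_{n+2,l} + β_{α,Φ} TS_{n+2,l+1})(1/α̲_F + K̲) + (β_{α,Φ}/α̲_F) TS_{n+1,l}]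
                                      + ᾱ_F β_{R,Φ} (Γ₂′)ⁿ K̲² TS_{n+2,l}`                                      (✶)

(`abs_integral_H2_diagram_le`, stated with the three coefficients collected), and the TABLES FORM
`abs_integral_H2_diagram_le_boundH2`: for a table `τ` with `TS_{m,l}(x) ≤ τ.T m l x` and arguments with
`(Γ₂′)ⁿ β_{R,Φ} ≤ β_{ΔR,Φ}`, the left side is `≤ F3Bounds.boundH2 τ n l x r`.

READING NOTE (Lean-vs-print, recorded in the packet's DIVERGENCE.md; nothing here decides it).  The printed (3.73)/(3.74) and
`General.nb` `BoundH[2]` (= `F3Bounds.boundH2`, transcribed verbatim and UNCHANGED) carry `β_{ΔR,Φ}` in the slot where (3.53)'s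
`α_F R̂_Φ(k)/[1−F̂]²` is bounded, and their last term `ᾱ_F β_{ΔR,Φ} K̲² T*_{n+2,l}` carries no `(Γ₂′)ⁿ`; the bound (✶) derived here
from (3.53) has `ᾱ_F β_{R,Φ} (Γ₂′)ⁿ K̲²` there.  Hence (✶) `≤ boundH2` exactly when the tables dominate the `TS`-slots and
`(Γ₂′)ⁿ β_{R,Φ} ≤ β_{ΔR,Φ}` — both are HYPOTHESES of the Tables form, to be discharged by a consumer on displayed binders.
For the `T`-slots the module also proves `TS_{m,l} ≤ K_{m,l+1} + (1/α̲_F)·min{(4/d) K_{m,l}, (2/d) K_{m+1,l}}` ((5.10)–(5.12)) and,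
when `α̲_F ≥ 1`, `TS_{m,l} ≤ K_{m,l+1} + min{(4/d) K_{m,l}, (2/d) K_{m+1,l}}` — the right side of (5.11) = the notebook's
`T[m,l] = K[m,l+1] + Min[4/d K[m,l], 2/d K[m+1,l]]` read at the true `K`-integrals.

Pattern = `NobleH4StepD75` (integral monotonicity against an integrable majorant via a generic shell; the left integrand need not
be shown integrable).  This is the (S2b)-IMPR leaf L4 of LEMMAS (I3); L3 (H₁) is NOT in this module.
[cite: FitznerVanDerHofstad2016NoBLE, §3.3.5 Step 2 (3.72)–(3.74) p. 1077 with (3.53), (3.58) pp. 1073–1074, §3.3.4 (3.36)–(3.38),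
 (3.40)–(3.47) pp. 1071–1072, §5.2 (5.10)–(5.12) p. 1092; FitznerVanDerHofstad2017, notebook General.nb In[2] `BoundH[2]`,
 SRW.nb `T[n,l,v]`; HeydenreichVanDerHofstad2017, Prop. 5.5]
-/

noncomputable section

open MeasureTheory Real
open Literature.Barriers.CriticalPhenomena
open Literature.Barriers.CriticalPhenomena.Slade2006Prop53 (P)
open Literature.Probability.LatticeModels

namespace Literature.Probability.FitznerVanDerHofstad2017

variable {d : ℕ}

/-! ## A generic integration shell: three monomials -/

/-- If `0 ≤ f` and `f ≤ c₁ F₁ + c₂ F₂ + c₃ F₃` at every `k` of the cube with `D̂(k) < 1`, with `F₁, F₂, F₃` integrable, then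
`∫ f dk/(2π)^d ≤ c₁ ∫ F₁ dk/(2π)^d + c₂ ∫ F₂ dk/(2π)^d + c₃ ∫ F₃ dk/(2π)^d` (`f` itself need not be shown integrable). [folklore] -/
theorem integral_div_le_of_le_three_monomials (hd : 1 ≤ d) {f F₁ F₂ F₃ : (Fin d → ℝ) → ℝ} {c₁ c₂ c₃ : ℝ}
    (hf : ∀ k, 0 ≤ f k) (hF₁ : Integrable F₁ (P d)) (hF₂ : Integrable F₂ (P d)) (hF₃ : Integrable F₃ (P d))
    (h : ∀ k ∈ cube d, Dhat d k < 1 → f k ≤ c₁ * F₁ k + c₂ * F₂ k + c₃ * F₃ k) :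
    (∫ k, f k ∂P d) / (2 * π) ^ d ≤
      c₁ * ((∫ k, F₁ k ∂P d) / (2 * π) ^ d) + c₂ * ((∫ k, F₂ k ∂P d) / (2 * π) ^ d) +
        c₃ * ((∫ k, F₃ k ∂P d) / (2 * π) ^ d) := by
  have h12 : Integrable (fun k => c₁ * F₁ k + c₂ * F₂ k) (P d) := (hF₁.const_mul c₁).add (hF₂.const_mul c₂)
  have hle : (∫ k, f k ∂P d) ≤ ∫ k, c₁ * F₁ k + c₂ * F₂ k + c₃ * F₃ k ∂P d := by
    refine integral_mono_of_nonneg (ae_of_all _ hf) (h12.add (hF₃.const_mul c₃)) ?_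
    filter_upwards [ae_mem_cube_and_Dhat_lt_one hd] with k hk
    exact h k hk.1 hk.2
  rw [integral_add h12 (hF₃.const_mul c₃), integral_add (hF₁.const_mul c₁) (hF₂.const_mul c₂),
    integral_const_mul, integral_const_mul, integral_const_mul] at hle
  have h2 := two_pi_pow_pos d
  calc (∫ k, f k ∂P d) / (2 * π) ^ d
      ≤ (c₁ * ∫ k, F₁ k ∂P d + c₂ * ∫ k, F₂ k ∂P d + c₃ * ∫ k, F₃ k ∂P d) / (2 * π) ^ d :=
        div_le_div_of_nonneg_right hle h2.le
    _ = _ := by ring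

/-! ## The `T*`-slot majorant `TS_{m,l}(x) = K_{m,l+1}(x) + (2/α̲_F) U_{m+1,l}(x)` -/

/-- `TS_{m,l}(x) := K_{m,l+1}(x) + (2/a) U_{m+1,l}(x)`: the integral of `|D̂|^l Ĉ^m |D̂^{(x)}| · (|D̂| + 2 D̂^{sin} Ĉ/a)`, which for
`a = α̲_F` dominates the integrand `|D̂|^l Ĉ^m |D̂^{(x)}| |M̂*|` of `T*_{m,l}(x)` ((3.72)) through `|M̂*| ≤ |D̂| + 2 D̂^{sin} Ĉ/α̲_F`.
[cite: FitznerVanDerHofstad2016NoBLE, §3.3.5 (3.72) p. 1077 with §3.3.4 (3.36), (3.38), (3.43) pp. 1071–1072] -/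
def srwTS (d : ℕ) (a : ℝ) (m l : ℕ) (x : Fin d → ℤ) : ℝ :=
  srwK d m (l + 1) x + 2 / a * srwU d (m + 1) l x

/-- `TS ≥ 0` for `a ≥ 0`. [folklore] -/
theorem srwTS_nonneg {a : ℝ} (ha : 0 ≤ a) (m l : ℕ) (x : Fin d → ℤ) : 0 ≤ srwTS d a m l x :=
  add_nonneg (srwK_nonneg _ _ _) (mul_nonneg (div_nonneg two_pos.le ha) (srwU_nonneg _ _ _))

/-- The `TS`-integrand splits into the `K_{m,l+1}`-integrand plus `2/a` times the `U_{m+1,l}`-integrand. [folklore] -/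
theorem srwTS_integrand_eq (a : ℝ) (m l : ℕ) (x : Fin d → ℤ) (k : Fin d → ℝ) :
    (|Dhat d k| ^ l * |DhatSym d x k|) * (Chat d 1 k ^ m * (|Dhat d k| + 2 / a * (Dsin d k * Chat d 1 k))) =
      (|Dhat d k| ^ (l + 1) * |DhatSym d x k|) * Chat d 1 k ^ m +
        2 / a * ((|Dhat d k| ^ l * |DhatSym d x k| * Dsin d k) * Chat d 1 k ^ (m + 1)) := by
  ring

/-- The `TS`-integrand is integrable for `d ≥ 2m + 3`. [folklore] -/
theorem integrable_srwTS_integrand {m : ℕ} (hd : 2 * (m + 1) + 1 ≤ d) (a : ℝ) (l : ℕ) (x : Fin d → ℤ) :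
    Integrable (fun k => (|Dhat d k| ^ l * |DhatSym d x k|) *
      (Chat d 1 k ^ m * (|Dhat d k| + 2 / a * (Dsin d k * Chat d 1 k)))) (P d) := by
  simp_rw [srwTS_integrand_eq]
  exact (integrable_srwK_integrand (n := m) (by omega) (l + 1) x).add ((integrable_srwU_integrand hd l x).const_mul _)

/-- The `TS`-dictionary: `∫ |D̂|^l |D̂^{(x)}| Ĉ^m (|D̂| + 2 D̂^{sin} Ĉ/a) dk/(2π)^d = TS_{m,l}(x)` (`d ≥ 2m + 3`).
[cite: FitznerVanDerHofstad2016NoBLE, §3.3.4 (3.36), (3.38) p. 1071] -/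
theorem integral_srwTS_integrand_eq {m : ℕ} (hd : 2 * (m + 1) + 1 ≤ d) (a : ℝ) (l : ℕ) (x : Fin d → ℤ) :
    (∫ k, (|Dhat d k| ^ l * |DhatSym d x k|) * (Chat d 1 k ^ m * (|Dhat d k| + 2 / a * (Dsin d k * Chat d 1 k))) ∂P d) /
        (2 * π) ^ d = srwTS d a m l x := by
  simp_rw [srwTS_integrand_eq]
  rw [integral_add (integrable_srwK_integrand (n := m) (by omega) (l + 1) x)
      ((integrable_srwU_integrand hd l x).const_mul _),
    integral_const_mul, srwTS, srwK, srwU]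
  ring

/-- **`U_{m+1,l}(x) ≤ (2/d) K_{m,l}(x)`** (`D̂^{sin} Ĉ ≤ 2/d`; `d ≥ 2m + 3`). [cite: FitznerVanDerHofstad2016NoBLE, §5.2 (5.10) p. 1092] -/
theorem srwU_succ_le {m : ℕ} (hd : 2 * (m + 1) + 1 ≤ d) (l : ℕ) (x : Fin d → ℤ) :
    srwU d (m + 1) l x ≤ 2 / d * srwK d m l x := by
  have hd1 : 1 ≤ d := by omega
  unfold srwU srwK
  rw [mul_div_assoc', ← integral_const_mul]
  refine div_le_div_of_nonneg_right ?_ (two_pi_pow_pos d).le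
  refine integral_mono_of_nonneg (ae_of_all _ fun k => ?_)
    ((integrable_srwK_integrand (n := m) (by omega) l x).const_mul _) (ae_of_all _ fun k => ?_)
  · exact mul_nonneg (mul_nonneg (mul_nonneg (pow_nonneg (abs_nonneg _) l) (abs_nonneg _)) (Dsin_nonneg k))
      (pow_nonneg (Chat_one_nonneg k) _)
  · have hw : 0 ≤ |Dhat d k| ^ l * |DhatSym d x k| * Chat d 1 k ^ m :=
      mul_nonneg (mul_nonneg (pow_nonneg (abs_nonneg _) l) (abs_nonneg _)) (pow_nonneg (Chat_one_nonneg k) m)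
    have hDC : Dsin d k * Chat d 1 k ≤ 2 / d := by
      have := two_mul_Dsin_mul_Chat_le hd1 k
      have h4 : (4 : ℝ) / d = 2 * (2 / d) := by ring
      linarith
    calc (|Dhat d k| ^ l * |DhatSym d x k| * Dsin d k) * Chat d 1 k ^ (m + 1)
        = (|Dhat d k| ^ l * |DhatSym d x k| * Chat d 1 k ^ m) * (Dsin d k * Chat d 1 k) := by ring
      _ ≤ (|Dhat d k| ^ l * |DhatSym d x k| * Chat d 1 k ^ m) * (2 / d) := mul_le_mul_of_nonneg_left hDC hw
      _ = 2 / d * ((|Dhat d k| ^ l * |DhatSym d x k|) * Chat d 1 k ^ m) := by ring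

/-- **`TS_{m,l} ≤ K_{m,l+1} + (1/a)·min{(4/d) K_{m,l}, (2/d) K_{m+1,l}}`** (`a > 0`, `d ≥ 2m + 3`): the two branches of (5.11)
for the `T*`-slot, with the factor `1/α̲_F` from `Ĉ* ≤ Ĉ/α̲_F` kept explicit.
[cite: FitznerVanDerHofstad2016NoBLE, §5.2 (5.10)–(5.12) p. 1092 and §3.3.4 (3.43) p. 1072] -/
theorem srwTS_le {m : ℕ} (hd : 2 * (m + 1) + 1 ≤ d) {a : ℝ} (ha : 0 < a) (l : ℕ) (x : Fin d → ℤ) :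
    srwTS d a m l x ≤ srwK d m (l + 1) x + 1 / a * min (4 / d * srwK d m l x) (2 / d * srwK d (m + 1) l x) := by
  have h1 := srwU_succ_le hd l x
  have h2 := srwU_le (n := m + 1) hd l x
  have hmin : 2 * srwU d (m + 1) l x ≤ min (4 / d * srwK d m l x) (2 / d * srwK d (m + 1) l x) := by
    refine le_min ?_ ?_
    · have : (4 : ℝ) / d * srwK d m l x = 2 * (2 / d * srwK d m l x) := by ring
      linarith
    · have : (2 : ℝ) / d * srwK d (m + 1) l x = 2 * (srwK d (m + 1) l x / d) := by ring
      linarith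
  unfold srwTS
  rw [show 2 / a * srwU d (m + 1) l x = 1 / a * (2 * srwU d (m + 1) l x) by ring]
  exact add_le_add le_rfl (mul_le_mul_of_nonneg_left hmin (one_div_pos.2 ha).le)

/-- **`TS_{m,l} ≤ K_{m,l+1} + min{(4/d) K_{m,l}, (2/d) K_{m+1,l}}` when `α̲_F ≥ 1`** — the right side of (5.11) = the notebook's
`T[m,l] = K[m,l+1] + Min[4/d K[m,l], 2/d K[m+1,l]]` read at the true `K`-integrals.
[cite: FitznerVanDerHofstad2016NoBLE, §5.2 (5.11) p. 1092; FitznerVanDerHofstad2017, notebook SRW.nb `T[n,l,v]`] -/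
theorem srwTS_le_of_one_le {m : ℕ} (hd : 2 * (m + 1) + 1 ≤ d) {a : ℝ} (ha : 1 ≤ a) (l : ℕ) (x : Fin d → ℤ) :
    srwTS d a m l x ≤ srwK d m (l + 1) x + min (4 / d * srwK d m l x) (2 / d * srwK d (m + 1) l x) := by
  have ha0 : 0 < a := by linarith
  have hmin : 0 ≤ min (4 / d * srwK d m l x) (2 / d * srwK d (m + 1) l x) :=
    le_min (mul_nonneg (by positivity) (srwK_nonneg _ _ _)) (mul_nonneg (by positivity) (srwK_nonneg _ _ _))
  have h1a : 1 / a ≤ 1 := by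
    rw [div_le_iff₀ ha0]
    linarith
  exact (srwTS_le hd ha0 l x).trans (add_le_add le_rfl (mul_le_of_le_one_left hmin h1a))

/-! ## Pointwise: Step 2 with the `n` two-point lines and the `M̂*`-majorant -/

namespace LapAtoms.KeyBounds

variable {a : LapAtoms} {r : F3Bounds.Args} (h : a.KeyBounds r)
include h

/-- **Step 2 with the `n` two-point lines, pointwise**: `|Ĝ|ⁿ |Ĥ₂| ≤` the three `TS`-type monomials of (✶) —
`(Γ₂′)ⁿ [β_{|ΔR,F|} K̲ c̄_Φ (1/α̲_F + K̲) + ᾱ_F β_{R,Φ} K̲²] · Ĉ^{n+2}(|D̂| + 2 D̂^{sin} Ĉ/α̲_F)`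
`+ (Γ₂′)ⁿ β_{|ΔR,F|} K̲ β_{α,Φ} (1/α̲_F + K̲) · Ĉ^{n+2} |D̂| (|D̂| + 2 D̂^{sin} Ĉ/α̲_F) + (Γ₂′)ⁿ β_{|ΔR,F|} K̲ (β_{α,Φ}/α̲_F) · Ĉ^{n+1}(|D̂| + 2 D̂^{sin} Ĉ/α̲_F)`
(from `abs_H2_le`, `abs_Mstar_le'`, `abs_G_le`). [cite: FitznerVanDerHofstad2016NoBLE, §3.3.5 (3.53), (3.72)–(3.73) pp. 1073, 1077 with §3.3.4 (3.43), (3.47) p. 1072] -/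
theorem pow_abs_G_mul_abs_H2_le (n : ℕ) :
    |a.G| ^ n * |a.H2| ≤
      r.Gamma2dash ^ n *
            (r.bRfDelta * r.Kunderline * r.cp * (1 / r.afmin + r.Kunderline) + r.afmax * r.bRp * r.Kunderline ^ 2) *
          ((1 / (1 - a.D)) ^ (n + 2) * (|a.D| + 2 / r.afmin * (a.Dsin * (1 / (1 - a.D))))) +
        r.Gamma2dash ^ n * (r.bRfDelta * r.Kunderline * r.ap * (1 / r.afmin + r.Kunderline)) *
          ((1 / (1 - a.D)) ^ (n + 2) * |a.D| * (|a.D| + 2 / r.afmin * (a.Dsin * (1 / (1 - a.D))))) +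
        r.Gamma2dash ^ n * (r.bRfDelta * r.Kunderline * (r.ap / r.afmin)) *
          ((1 / (1 - a.D)) ^ (n + 1) * (|a.D| + 2 / r.afmin * (a.Dsin * (1 / (1 - a.D))))) := by
  have hC : 0 < 1 / (1 - a.D) := h.C_pos
  have hK : 0 ≤ r.Kunderline := h.K_nn
  have hΓ : 0 ≤ r.Gamma2dash := h.Gamma2dash_nn
  have hbF : 0 ≤ r.bRfDelta := h.bRfDelta_nn
  have hbp : 0 ≤ r.bRp := h.bRp_nn
  have hap : 0 ≤ r.ap := h.ap_nn
  have hcp : 0 ≤ r.cp := h.cp_nn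
  have haf : 0 < r.afmin := h.afmin_pos
  have hafx : 0 ≤ r.afmax := h.afmin_pos.le.trans (h.αF_ge.trans h.αF_le)
  have hDs : 0 ≤ a.Dsin := h.Dsin_nn
  have hG : |a.G| ^ n ≤ (r.Gamma2dash * (1 / (1 - a.D))) ^ n :=
    pow_le_pow_left₀ (abs_nonneg _) h.abs_G_le n
  have hP : 0 ≤ r.bRfDelta * r.Kunderline *
        ((r.cp + r.ap * |a.D|) * (1 / r.afmin + r.Kunderline) * (1 / (1 - a.D)) ^ 2 +
          r.ap / r.afmin * (1 / (1 - a.D))) +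
      r.afmax * r.bRp * r.Kunderline ^ 2 * (1 / (1 - a.D)) ^ 2 := by positivity
  calc |a.G| ^ n * |a.H2|
      ≤ (r.Gamma2dash * (1 / (1 - a.D))) ^ n *
          (r.bRfDelta * r.Kunderline *
              ((r.cp + r.ap * |a.D|) * (1 / r.afmin + r.Kunderline) * (1 / (1 - a.D)) ^ 2 +
                r.ap / r.afmin * (1 / (1 - a.D))) * |a.Mstar| +
            r.afmax * r.bRp * r.Kunderline ^ 2 * (1 / (1 - a.D)) ^ 2 * |a.Mstar|) :=
        mul_le_mul hG h.abs_H2_le (abs_nonneg _) (by positivity)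
    _ = (r.Gamma2dash * (1 / (1 - a.D))) ^ n *
          (r.bRfDelta * r.Kunderline *
              ((r.cp + r.ap * |a.D|) * (1 / r.afmin + r.Kunderline) * (1 / (1 - a.D)) ^ 2 +
                r.ap / r.afmin * (1 / (1 - a.D))) +
            r.afmax * r.bRp * r.Kunderline ^ 2 * (1 / (1 - a.D)) ^ 2) * |a.Mstar| := by ring
    _ ≤ (r.Gamma2dash * (1 / (1 - a.D))) ^ n *
          (r.bRfDelta * r.Kunderline *
              ((r.cp + r.ap * |a.D|) * (1 / r.afmin + r.Kunderline) * (1 / (1 - a.D)) ^ 2 +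
                r.ap / r.afmin * (1 / (1 - a.D))) +
            r.afmax * r.bRp * r.Kunderline ^ 2 * (1 / (1 - a.D)) ^ 2) *
          (|a.D| + 2 * a.Dsin * (1 / (1 - a.D) / r.afmin)) :=
        mul_le_mul_of_nonneg_left h.abs_Mstar_le' (by positivity)
    _ = _ := by ring

end LapAtoms.KeyBounds

/-! ## Integrated: Step 2 against the `(l,x)`-kernel -/

section Integrated

variable {n : ℕ} {A : (Fin d → ℝ) → LapAtoms} {r : F3Bounds.Args}

/-- **Step 2 integrated, absolute form**: `∫ |Ĝ|ⁿ |Ĥ₂| |D̂|^l |D̂^{(x)}| dk/(2π)^d ≤` the three `TS`-monomials of (✶) (`d ≥ 2n + 7`).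
[cite: FitznerVanDerHofstad2016NoBLE, §3.3.5 (3.72)–(3.74) p. 1077; §3.3.4 (3.36), (3.38) p. 1071] -/
theorem integral_pow_abs_G_mul_abs_H2_weight_le (hd : 2 * (n + 3) + 1 ≤ d)
    (hA : ∀ k ∈ cube d, Dhat d k < 1 → (A k).KeyBounds r) (hAD : ∀ k, (A k).D = Dhat d k)
    (hADs : ∀ k, (A k).Dsin = Dsin d k) (l : ℕ) (x : Fin d → ℤ) :
    (∫ k, |(A k).G| ^ n * |(A k).H2| * (|Dhat d k| ^ l * |DhatSym d x k|) ∂P d) / (2 * π) ^ d ≤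
      r.Gamma2dash ^ n *
            (r.bRfDelta * r.Kunderline * r.cp * (1 / r.afmin + r.Kunderline) + r.afmax * r.bRp * r.Kunderline ^ 2) *
          srwTS d r.afmin (n + 2) l x +
        r.Gamma2dash ^ n * (r.bRfDelta * r.Kunderline * r.ap * (1 / r.afmin + r.Kunderline)) *
          srwTS d r.afmin (n + 2) (l + 1) x +
        r.Gamma2dash ^ n * (r.bRfDelta * r.Kunderline * (r.ap / r.afmin)) * srwTS d r.afmin (n + 1) l x := by
  have hI1 := integrable_srwTS_integrand (d := d) (m := n + 2) (by omega) r.afmin l x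
  have hI2 := integrable_srwTS_integrand (d := d) (m := n + 2) (by omega) r.afmin (l + 1) x
  have hI3 := integrable_srwTS_integrand (d := d) (m := n + 1) (by omega) r.afmin l x
  rw [← integral_srwTS_integrand_eq (m := n + 2) (by omega) r.afmin l x,
    ← integral_srwTS_integrand_eq (m := n + 2) (by omega) r.afmin (l + 1) x,
    ← integral_srwTS_integrand_eq (m := n + 1) (by omega) r.afmin l x]
  refine integral_div_le_of_le_three_monomials (by omega) (fun k => ?_) hI1 hI2 hI3 fun k hk hD => ?_
  · exact mul_nonneg (mul_nonneg (pow_nonneg (abs_nonneg _) n) (abs_nonneg _))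
      (mul_nonneg (pow_nonneg (abs_nonneg _) l) (abs_nonneg _))
  · have hb := (hA k hk hD).pow_abs_G_mul_abs_H2_le n
    have hC : 1 / (1 - (A k).D) = Chat d 1 k := by rw [hAD, Chat, one_mul]
    rw [hC, hADs, hAD] at hb
    have hw : 0 ≤ |Dhat d k| ^ l * |DhatSym d x k| := mul_nonneg (pow_nonneg (abs_nonneg _) l) (abs_nonneg _)
    calc |(A k).G| ^ n * |(A k).H2| * (|Dhat d k| ^ l * |DhatSym d x k|)
        ≤ (r.Gamma2dash ^ n *
                (r.bRfDelta * r.Kunderline * r.cp * (1 / r.afmin + r.Kunderline) + r.afmax * r.bRp * r.Kunderline ^ 2) *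
              (Chat d 1 k ^ (n + 2) * (|Dhat d k| + 2 / r.afmin * (Dsin d k * Chat d 1 k))) +
            r.Gamma2dash ^ n * (r.bRfDelta * r.Kunderline * r.ap * (1 / r.afmin + r.Kunderline)) *
              (Chat d 1 k ^ (n + 2) * |Dhat d k| * (|Dhat d k| + 2 / r.afmin * (Dsin d k * Chat d 1 k))) +
            r.Gamma2dash ^ n * (r.bRfDelta * r.Kunderline * (r.ap / r.afmin)) *
              (Chat d 1 k ^ (n + 1) * (|Dhat d k| + 2 / r.afmin * (Dsin d k * Chat d 1 k)))) *
            (|Dhat d k| ^ l * |DhatSym d x k|) :=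
          mul_le_mul_of_nonneg_right hb hw
      _ = _ := by ring

/-- **Step 2 for the signed diagram integrand**: `|∫ Ĥ₂ Ĝⁿ D̂^l D̂^{(x)} dk/(2π)^d| ≤` the three `TS`-monomials of (✶).
[cite: FitznerVanDerHofstad2016NoBLE, §3.3.5 (3.58) p. 1074 and (3.72)–(3.74) p. 1077] -/
theorem abs_integral_H2_diagram_le (hd : 2 * (n + 3) + 1 ≤ d)
    (hA : ∀ k ∈ cube d, Dhat d k < 1 → (A k).KeyBounds r) (hAD : ∀ k, (A k).D = Dhat d k)
    (hADs : ∀ k, (A k).Dsin = Dsin d k) (l : ℕ) (x : Fin d → ℤ) :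
    |(∫ k, (A k).H2 * (A k).G ^ n * Dhat d k ^ l * DhatSym d x k ∂P d) / (2 * π) ^ d| ≤
      r.Gamma2dash ^ n *
            (r.bRfDelta * r.Kunderline * r.cp * (1 / r.afmin + r.Kunderline) + r.afmax * r.bRp * r.Kunderline ^ 2) *
          srwTS d r.afmin (n + 2) l x +
        r.Gamma2dash ^ n * (r.bRfDelta * r.Kunderline * r.ap * (1 / r.afmin + r.Kunderline)) *
          srwTS d r.afmin (n + 2) (l + 1) x +
        r.Gamma2dash ^ n * (r.bRfDelta * r.Kunderline * (r.ap / r.afmin)) * srwTS d r.afmin (n + 1) l x := by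
  rw [abs_div, abs_of_pos (two_pi_pow_pos d)]
  refine le_trans (div_le_div_of_nonneg_right abs_integral_le_integral_abs (two_pi_pow_pos d).le) ?_
  have habs : ∀ k, |(A k).H2 * (A k).G ^ n * Dhat d k ^ l * DhatSym d x k| =
      |(A k).G| ^ n * |(A k).H2| * (|Dhat d k| ^ l * |DhatSym d x k|) := fun k => by
    simp only [abs_mul, abs_pow]; ring
  simp only [habs]
  exact integral_pow_abs_G_mul_abs_H2_weight_le hd hA hAD hADs l x

/-- **Tables form, Step 2**: for a table whose `T`-entries dominate the `TS`-slots (`TS_{m,l}(x) ≤ τ.T m l x`) and arguments with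
`(Γ₂′)ⁿ β_{R,Φ} ≤ β_{ΔR,Φ}` on the well-formed region, the bound is `F3Bounds.boundH2 τ n l x r` = (3.74) = `General.nb` `BoundH[2]`
(whose last term reads `ᾱ_F β_{ΔR,Φ} K̲² T[n+2,l]`; see the module docstring's READING NOTE for why the two hypotheses appear).
[cite: FitznerVanDerHofstad2016NoBLE, §3.3.5 (3.74) p. 1077; FitznerVanDerHofstad2017, notebook General.nb In[2]] -/
theorem abs_integral_H2_diagram_le_boundH2 (hd : 2 * (n + 3) + 1 ≤ d)
    (hA : ∀ k ∈ cube d, Dhat d k < 1 → (A k).KeyBounds r) (hAD : ∀ k, (A k).D = Dhat d k)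
    (hADs : ∀ k, (A k).Dsin = Dsin d k) (hr : r.WF) (hβ : r.Gamma2dash ^ n * r.bRp ≤ r.bRpDelta)
    (τ : F3Bounds.Tables (Fin d → ℤ)) (hT : ∀ m l x, srwTS d r.afmin m l x ≤ τ.T m l x) (l : ℕ) (x : Fin d → ℤ) :
    |(∫ k, (A k).H2 * (A k).G ^ n * Dhat d k ^ l * DhatSym d x k ∂P d) / (2 * π) ^ d| ≤ F3Bounds.boundH2 τ n l x r := by
  refine (abs_integral_H2_diagram_le hd hA hAD hADs l x).trans ?_
  obtain ⟨hΓ, hcp, haf, hafx, hap, hbp, hbF, -, hK⟩ := hr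
  have hT1 := hT (n + 2) l x
  have hT2 := hT (n + 2) (l + 1) x
  have hT3 := hT (n + 1) l x
  have hS1 : 0 ≤ srwTS d r.afmin (n + 2) l x := srwTS_nonneg haf.le _ _ _
  have hTT1 : 0 ≤ τ.T (n + 2) l x := hS1.trans hT1
  have a1 : 0 ≤ r.Gamma2dash ^ n *
      (r.bRfDelta * r.Kunderline * r.cp * (1 / r.afmin + r.Kunderline) + r.afmax * r.bRp * r.Kunderline ^ 2) := by
    positivity
  have a2 : 0 ≤ r.Gamma2dash ^ n * (r.bRfDelta * r.Kunderline * r.ap * (1 / r.afmin + r.Kunderline)) := by positivity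
  have a3 : 0 ≤ r.Gamma2dash ^ n * (r.bRfDelta * r.Kunderline * (r.ap / r.afmin)) := by positivity
  have e1 := mul_le_mul_of_nonneg_left hT1 a1
  have e2 := mul_le_mul_of_nonneg_left hT2 a2
  have e3 := mul_le_mul_of_nonneg_left hT3 a3
  have e4 : r.afmax * (r.Gamma2dash ^ n * r.bRp) * r.Kunderline ^ 2 * τ.T (n + 2) l x ≤
      r.afmax * r.bRpDelta * r.Kunderline ^ 2 * τ.T (n + 2) l x :=
    mul_le_mul_of_nonneg_right
      (mul_le_mul_of_nonneg_right (mul_le_mul_of_nonneg_left hβ hafx) (pow_nonneg hK 2)) hTT1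
  unfold F3Bounds.boundH2
  linarith [e1, e2, e3, e4]

end Integrated

/-! ## The atoms of `NobleLaplacianSplit` -/

/-- Step 2 at the atoms `lapAtomsAt` (whose `D`, `Dsin` fields are `D̂(k)`, `D̂^{sin}(k)` by construction), Tables form.
[cite: FitznerVanDerHofstad2016NoBLE, §3.3.5 (3.58), (3.72)–(3.74) pp. 1074–1077] -/
theorem abs_integral_H2_diagram_le_boundH2_lapAtomsAt {n : ℕ} (hd : 2 * (n + 3) + 1 ≤ d)
    {cΦ αΦ cF αF : ℝ} {RΦ RF : Site d → ℝ} {r : F3Bounds.Args}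
    (hKB : ∀ k ∈ cube d, Dhat d k < 1 → (lapAtomsAt d cΦ αΦ cF αF RΦ RF k).KeyBounds r)
    (hr : r.WF) (hβ : r.Gamma2dash ^ n * r.bRp ≤ r.bRpDelta)
    (τ : F3Bounds.Tables (Fin d → ℤ)) (hT : ∀ m l x, srwTS d r.afmin m l x ≤ τ.T m l x) (l : ℕ) (x : Fin d → ℤ) :
    |(∫ k, (lapAtomsAt d cΦ αΦ cF αF RΦ RF k).H2 * (lapAtomsAt d cΦ αΦ cF αF RΦ RF k).G ^ n *
        Dhat d k ^ l * DhatSym d x k ∂P d) / (2 * π) ^ d| ≤ F3Bounds.boundH2 τ n l x r :=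
  abs_integral_H2_diagram_le_boundH2 hd hKB (fun _ => rfl) (fun _ => rfl) hr hβ τ hT l x

end Literature.Probability.FitznerVanDerHofstad2017

end
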